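import Literature.AlgebraicGeometry.Frobenioids.Categories
import Mathlib.CategoryTheory.Comma.Over.Basic
import HarnessLib

/-!
# Frobenioids I, proof of Theorem 3.4 (v): over a SLIM category the functors `D_X → D_Y` are rigid
# ("2-slimness" of the 2-category of slices)

Mochizuki, *The geometry of Frobenioids I: the general theory*, Kyushu J. Math. **62** (2008)
293–400, proof of Thm. 3.4 (v), p. 67 l. 40 – p. 68 l. 5, with Def. A.1 (i) ("2-slim")
[cite: MochizukiFrdI2008, Thm. 3.4 (v) p.67]:

> "… since the category `D_i`, hence also the categories `(D_i)_{A_D}`, `(P_i)_A`, are slim, it follows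
> that the collection of categories `(P_i)_A` … and functors `(P_i)_{A'} → (P_i)_A` … determine a
> 2-slim [cf. Definition A.1, (i)] 2-category of 1-categories …"

PROOF-ONLY file (seat abc-iut-L1-d4 gen 2; brick of sub-node FrdI:Thm3.4(v)/L12 of
plan/L1/SUBDAG-FrdI-Thm34.md, companion of `SlimBaseDetection.lean`): the COHERENCE half of the slimness
input — in a slim category `D` every functor `Over.map f : D_X → D_Y` induced by an arrow is RIGID (has
no non-trivial automorphism), so that isomorphisms between such functors, when they exist, are unique;
this is what makes the "functors up to isomorphism" `(P_i)_{A'} → (P_i)_A` of the printed argument compose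
coherently. Mathlib only (`Over.map`, `Over.OverMorphism.ext`) over abc-iut-found's `IsSlim`,
`IsRigidFunctor`. Nothing of [FrdI] is restated.
-/

namespace Literature.AlgebraicGeometry.Frobenioids

open CategoryTheory

universe v u

variable {D : Type u} [Category.{v} D]

/-- In a slim category, the underlying arrow of every component of an automorphism of
`Over.map f : D_X → D_Y` is an identity. [cite: MochizukiFrdI2008, Thm. 3.4 (v) p.67] -/
theorem IsSlim.left_app_eq_id_of_over_map_auto (h : IsSlim D) {X Y : D} (f : X ⟶ Y)
    (θ : Over.map f ≅ Over.map f) (U : Over X) : (θ.hom.app U).left = 𝟙 U.left := by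
  -- the induced automorphism of `D_X → D`
  let α : Over.forget X ≅ Over.forget X :=
    NatIso.ofComponents (fun U => (Over.forget Y).mapIso (θ.app U)) (fun {U V} k => by
      have := congrArg CommaMorphism.left (θ.hom.naturality k)
      simp only [Over.comp_left, Over.map_map_left] at this
      exact this)
  have hα : α = Iso.refl _ := h.isRigid_forget X α
  exact congrArg (fun β : Over.forget X ≅ Over.forget X => β.hom.app U) hα

/-- **`D_X → D_Y` is rigid over a slim `D`** ("2-slim", Def. A.1 (i)): every automorphism of `Over.map f`
is the identity. [cite: MochizukiFrdI2008, Thm. 3.4 (v) p.67] -/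
theorem IsSlim.isRigidFunctor_over_map (h : IsSlim D) {X Y : D} (f : X ⟶ Y) :
    IsRigidFunctor (Over.map f) := by
  intro θ
  ext U
  rw [h.left_app_eq_id_of_over_map_auto f θ U]
  simp

/-- Consequently isomorphisms `Over.map f ≅ Over.map g` over a slim `D` are UNIQUE when they exist.
[cite: MochizukiFrdI2008, Thm. 3.4 (v) p.67] -/
theorem IsSlim.over_map_iso_unique (h : IsSlim D) {X Y : D} {f g : X ⟶ Y} (θ θ' : Over.map f ≅ Over.map g) :
    θ = θ' := by
  have h1 : θ ≪≫ θ'.symm = Iso.refl _ := h.isRigidFunctor_over_map f (θ ≪≫ θ'.symm)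
  calc θ = (θ ≪≫ θ'.symm) ≪≫ θ' := by rw [Iso.trans_assoc, Iso.symm_self_id, Iso.trans_refl]
    _ = θ' := by rw [h1, Iso.refl_trans]

end Literature.AlgebraicGeometry.Frobenioids
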